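import Summits.Ventures.LatticeQCDFlow.Scaling.OneSidedHubFloor
import Summits.Ventures.LatticeQCDFlow.Scaling.WeightedLadderLaw

/-!
HONEST FRAMING: exact (Metropolis-corrected) sampling algorithms for lattice gauge theory; figures
of merit are autocorrelation/cost numbers at stated couplings and volumes; no continuum-physics
claim.

# HubBeatsLadder — FROM `(K+1)(2K+1) ≥ 42t/(p·v·min{t, γ₀(1−t)})` ON, THE ONE-SIDED HOT-ONLY HUB OUT-RELAXES EVERY
# ADJACENT EXCHANGE SCHEME OVER THE SAME SECTOR-FROZEN COLD REPLICAS, WHATEVER ITS EXCHANGE MOVE AND UPDATE WEIGHTS: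
# `Gap(adjacent scheme) ≤ 3t/(vK(K+1)(2K+1)) ≤ p·min{t, γ₀(1−t)}/(14K) ≤ Gap(hub)` (lean-2 GEN-22, ours)

Venture-side (OURS).  Cell `lqcd-flow` (pub-lqcd), unit `pub-lqcd-lean-2-g22`, 2026-08-26.  Chapter J, file 14: a
comparison in numbers.  Same levels `μ_k`, same replica updates `M_k`, same swap fraction `t`.  LADDER: any exchange
scheme `t·Q + (1−t)·prodKernel w M` whose move `Q` is a `π̃`-reversible ADJACENT exchange (each transition permutes the
sector labels by one adjacent transposition) with ANY update weights `w`, over cold replicas whose own updates never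
cross the sector `A` (`Q_k(A,Aᶜ) = 0`, `k ≥ 1`; masses `μ_k(A)μ_k(Aᶜ) ≥ v`): `Scaling/WeightedLadderLaw`'s diffusive
ceiling `Gap ≤ 3t/(vK(K+1)(2K+1))`.  HUB: the hot-only star with identity maps under ONE-SIDED domination
`p·μ_{k+1} ≤ μ_0` and hot Poincaré constant `γ₀`: `Scaling/OneSidedHubFloor`'s `Gap ≥ p·min{t, γ₀(1−t)}/(14K)`.  The
two cross at `(K+1)(2K+1) = 42t/(p·v·min{t, γ₀(1−t)})`.

## What is proved

* `ladder_ceiling_le_hub_floor` — the arithmetic: `(K+1)(2K+1)·p·v·min{t,γ₀(1−t)} ≥ 42t` ⇒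
  `3t/(vK(K+1)(2K+1)) ≤ p·min{t,γ₀(1−t)}/(14K)`.
* **`hub_beats_adjacentScheme`** — under that replica-count condition, `Gap(adjacent scheme) ≤ Gap(hot-only hub)` for
  EVERY adjacent exchange move `Q` and EVERY allocation `w`.

Reading (no numerics implied): with one-sided domination (the map-assisted regime of J8/J9, `p` = sector
persistence) a modest number of replicas already makes direct exchange with the hot replica faster than any ladder
schedule over the same frozen cold levels; without domination (`p` = a partition-function ratio, J12) the crossover
replica count is astronomically large — the ladder wins, as in practice.  NOT CLAIMED: ladders whose cold replicas
cross sectors on their own; anything measured.  Literature grade (cell rule): ELEMENTARY COROLLARY; nothing cited as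
a fact; no new bib keys.
-/

noncomputable section

open Finset Function
open Literature.Probability.MarkovChains

namespace Summit.Ventures.LatticeQCDFlow.Scaling

section HubVsLadder

variable {S : Type*} [Fintype S] [DecidableEq S] {K : ℕ} {μ : Fin (K + 1) → S → ℝ}
  {M : Fin (K + 1) → S → S → ℝ} {w : Fin (K + 1) → ℝ} {t : ℝ}

omit [Fintype S] [DecidableEq S] in
/-- The crossover arithmetic: `42t ≤ (K+1)(2K+1)·p·v·m` gives `3t/(vK(K+1)(2K+1)) ≤ p·m/(14K)` (`K, v > 0`).
[ours] -/
theorem ladder_ceiling_le_hub_floor {p v m : ℝ} (hK : 0 < (K : ℝ)) (hv : 0 < v)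
    (hcross : 42 * t ≤ ((K : ℝ) + 1) * (2 * K + 1) * (p * v * m)) :
    3 * t / (v * (K * (K + 1) * (2 * K + 1))) ≤ p * m / (14 * K) := by
  rw [div_le_div_iff₀ (by positivity) (by positivity)]
  calc 3 * t * (14 * K) = K * (42 * t) := by ring
    _ ≤ K * (((K : ℝ) + 1) * (2 * K + 1) * (p * v * m)) := mul_le_mul_of_nonneg_left hcross hK.le
    _ = p * m * (v * (K * (K + 1) * (2 * K + 1))) := by ring

/-- **THE ONE-SIDED HUB OUT-RELAXES EVERY ADJACENT EXCHANGE SCHEME** over the same sector-frozen cold replicas once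
`(K+1)(2K+1)·p·v·min{t, γ₀(1−t)} ≥ 42t`: for every `π̃`-reversible adjacent exchange move `Q` and every allocation
`w` of the updates, `Gap(t·Q + (1−t)·prodKernel w M) ≤ Gap(hot-only star)` (`K ≥ 1`, `0 < t < 1`, `|S| ≥ 2`; hub:
one-sided domination `p·μ_{k+1} ≤ μ_0`, hot Poincaré constant `γ₀`; ladder: cold updates never cross `A`,
`μ_k(A)μ_k(Aᶜ) ≥ v > 0` for `k ≥ 1`). [ours] -/
theorem hub_beats_adjacentScheme [Nontrivial S] (hK : 1 ≤ K) (hμ : ∀ k x, 0 < μ k x) (hμ1 : ∀ k, ∑ u, μ k u = 1)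
    (hM : ∀ k, IsRowStochastic (M k)) (hMrev : ∀ k, DetailedBalance (μ k) (M k)) (hw0 : ∀ k, 0 ≤ w k)
    (hw1 : ∑ k, w k = 1) (ht0 : 0 < t) (ht1 : t < 1) {p γ₀ : ℝ} (hp : 0 < p) (hp1 : p ≤ 1) (hγ₀ : 0 < γ₀)
    (hdom : ∀ (k : Fin K) (u : S), p * μ k.succ u ≤ μ 0 u)
    (hgap0 : ∀ h : S → ℝ, γ₀ * lawVariance (μ 0) h ≤ dirichletForm (μ 0) (M 0) h)
    {Q : Matrix (Fin (K + 1) → S) (Fin (K + 1) → S) ℝ} (hQ : IsRowStochastic Q) (hQrev : DetailedBalance (tensorFun μ) Q)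
    {A : Finset S} (hQadj : ∀ x y, Q x y ≠ 0 → y ≠ x → ∃ j : Fin K, ∀ k, (y k ∈ A ↔ x (levelSwap j k) ∈ A))
    {v : ℝ} (hvpos : 0 < v) (hv : ∀ k : Fin (K + 1), k ≠ 0 → v ≤ (∑ u ∈ A, μ k u) * ∑ u ∈ Aᶜ, μ k u)
    (hfrozen : ∀ k : Fin (K + 1), k ≠ 0 → edgeMeasure (μ k) (M k) A Aᶜ = 0)
    (hcross : 42 * t ≤ ((K : ℝ) + 1) * (2 * K + 1) * (p * v * min t (γ₀ * (1 - t)))) :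
    spectralGap (tensorFun μ) (fun x y : Fin (K + 1) → S => t * Q x y + (1 - t) * prodKernel w M x y)
      ≤ spectralGap (tensorFun μ) (fun x y : Fin (K + 1) → S =>
          t * ptGraphSwap μ (fun k : Fin K => ((0 : Fin (K + 1)), k.succ)) (fun _ : Fin K => Equiv.refl S) x y
            + (1 - t) * prodKernel (fun k : Fin (K + 1) => if k = 0 then (1 : ℝ) else 0) M x y) := by
  have hKpos : (0 : ℝ) < K := Nat.cast_pos.mpr (by omega)
  have hladder := weightedAdjacentSchemeFrozen_spectralGap_le (w := w) hK hμ hμ1 hM hMrev hw0 hw1 ht0.le ht1.le hQ hQrev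
    hQadj hvpos hv hfrozen
  have hhub := (oneSidedHotOnlyStar_spectralGap_two_sided (M := M) hK hμ hμ1 hM hMrev ht0 ht1 hp hp1 hγ₀ hdom hgap0
    (A := A) hvpos hv).1
  exact hladder.trans ((ladder_ceiling_le_hub_floor hKpos hvpos hcross).trans hhub)

end HubVsLadder

end Summit.Ventures.LatticeQCDFlow.Scaling

end
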